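import Summits.CriticalPhenomena.PercolationContinuityZ3.Theorems.PercNearOneGluingNoHeavyLowerTailWorstPairExchangeCex
import HarnessLib

/-!
# `NoHeavyLowerTail` (stmt-CriticalPhenomena-4575) — k-cluster line: the LAST three-cluster cell ("AS[oo]") is false too
# (certified 8-vertex witness; closes the three-cluster conditional-association inventory)

Support file (literature seat `prim-lit-2`, `--supports stmt-CriticalPhenomena-4575`; evaluation pattern of
`PercNearOneGluingNoHeavyLowerTailThreeClusterCPACex.lean` (prim-hp-7) on `Fin 8`: `native_decide` on four
1024-term exact rational sums).  No definitions, no named facts, no sorries.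

**Background.**  The three-cluster census `hp7-three-cluster-cells` (prim-hp-7 memo
run/shared/lean/prim/prim-hp-7/HP7-K3-INVENTORY.md; ttrl2 run/shared/lean/ttrl/k3cells/README.md, FINAL 2026-08-19)
refuted every conjectured three-cluster strengthening of van den Berg–Häggström–Kahn's two-group rows
[VandenbergHaggstromKahn2005, Thms. 1.2–1.5, 2.1] except one, "AS[oo]": for pairwise distinct `s,t,u,a,b`, with
`E := {s ↮ t} ∩ {s ↮ u} ∩ {t ↮ u} ∩ {a, b ∉ C_t ∪ C_u}`,
`Cov(1{s ↔ a}, 1{s ↔ b} | E) ≥ 0` (equivalently `M_ss·M_oo ≥ M_so·M_os` for the destination matrix of `a, b`), which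
had no counterexample in 126 M exhaustive instances on `n ≤ 7` vertices and 10⁵ ratio climbs.  Its printed-strength
shadow — the same inequality with `μ(E)` weakened to `μ({s↮t} ∩ {s↮u})` — is the tree theorem
`Literature.Probability.Percolation.threeSep_assort_oo_exchange` (BHK Thm. 2.1 at `q = 1`, set pair `({s},{t,u})`).

**This file: AS[oo] is false.**  Witness (`Fin 8`; `s = 0, t = 1, u = 2, a = 3, b = 4, x = 5, h = 6, y = 7`): edges
`t–x, x–h, u–y, h–y, s–x, s–y, a–x, b–y` of weight `1/2` and the two hub edges `t–h, u–h` of weight `999/1000`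
("bowtie + s + two pendants").  Exactly: `μ(E) = 84009/2.56·10⁸`, `μ(E ∩ {0↔3}) = μ(E ∩ {0↔4}) = 13008/2.56·10⁸`,
`μ(E ∩ {0↔3} ∩ {0↔4}) = 2004/2.56·10⁸`, and `μ(E)·μ(E ∩ {0↔3} ∩ {0↔4}) − μ(E ∩ {0↔3})·μ(E ∩ {0↔4}) = −213507/1.6384·10¹⁶ < 0`
(`84009·2004 = 168354036 < 169208064 = 13008²`; conditionally on `E`: `P(0↔3, 0↔4) = 0.023855 < P(0↔3)·P(0↔4) = 0.023976`).  Mechanism (hub dichotomy, as for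
K3-A/U1): `E` forces exactly one hub edge closed (up to `O(ε)`), a latent fair coin "h stays with t" / "h stays with u";
on the branch "h with t" the residual constraint `t ↮ u` prunes one of `y`'s four local states (`P(y ∉ C_t∪C_u) = 1/3`
vs `P(x ∉ C_t∪C_u) = 1/4`), so `{s ↔ b}` (routed through `y`) prefers that branch and `{s ↔ a}` (through `x`) the
other; within a branch they are independent; the covariance ratio tends to `169/168` as `ε → 0` (threshold
`ε* ≈ 0.0069`; fair-coin multigraph form at `ε = 1/256`: `516·15357 < 2820²`).  Details: prim-lit-2 LITERATURE-2.md §11.2.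

* `ThreeClusterAssortCex.real_inter_of_tests` — evaluation of `μ(E ∩ X)` (`Fin 8`) for events `E`, `X` given by `Bool` tests
  on the reach table (no definitions are declared: the event `E` and its test are written out literally);
* `ThreeClusterAssortCex.eTest_iff` — the literal `Bool` test of `E`;  `ThreeClusterAssortCex.violation_of_check` — one
  decidable rational fact ⇒ the violating instance;
* `threeClusterAssort_cex` — the instance;  `threeClusterAssort_false` — `¬`(AS[oo]) over all finite weighted graphs.
-/

namespace Summit.CriticalPhenomena.PercolationContinuityZ3.Theorems

open MeasureTheory
open Literature.Probability.LatticeModels Literature.Probability.Percolation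
open Summit.CriticalPhenomena.PercolationContinuityZ3.Theorems.AdditiveGluing.Negative.Cert

namespace ThreeClusterAssortCex

open WorstPairExchangeCex (real_eq_wcount)

/-- `Bool` conjunction tracks set intersection. [folklore] -/
theorem band_mem {α : Type*} {b₁ b₂ : Bool} {x : α} {A B : Set α} (h₁ : b₁ = true ↔ x ∈ A)
    (h₂ : b₂ = true ↔ x ∈ B) : (b₁ && b₂) = true ↔ x ∈ A ∩ B := by
  rw [Bool.and_eq_true, h₁, h₂, Set.mem_inter_iff]

/-- `Bool` negation tracks set complement. [folklore] -/
theorem bnot_mem {α : Type*} {b : Bool} {x : α} {A : Set α} (h : b = true ↔ x ∈ A) :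
    (!b) = true ↔ x ∈ Aᶜ := by
  rw [Set.mem_compl_iff]
  cases b <;> simp_all

/-- The literal `Bool` test of `E = {0↮1} ∩ {0↮2} ∩ ({1↮2} ∩ {1↮3} ∩ {2↮3} ∩ {1↮4} ∩ {2↮4})` on the reach table of a
configuration decides membership in `E` (`Fin 8`). [this file] -/
theorem eTest_iff (ω : List (Fin 8 × Fin 8)) :
    (fun tb : List ℕ =>
        ((!(tb.getD 0 0).testBit 1 && !(tb.getD 0 0).testBit 2) &&
          ((((!(tb.getD 1 0).testBit 2 && !(tb.getD 1 0).testBit 3) && !(tb.getD 2 0).testBit 3) &&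
            !(tb.getD 1 0).testBit 4) && !(tb.getD 2 0).testBit 4))) (reachTable 8 ω) = true ↔
      (↑(Eset ω) : Set (Sym2 (Fin 8))) ∈
      ((openConn (0 : Fin 8) (1 : Fin 8) : Set (BondConfig (Fin 8)))ᶜ ∩ (openConn (0 : Fin 8) (2 : Fin 8))ᶜ ∩
        ((openConn (1 : Fin 8) (2 : Fin 8))ᶜ ∩ (openConn (1 : Fin 8) (3 : Fin 8))ᶜ ∩ (openConn (2 : Fin 8) (3 : Fin 8))ᶜ ∩
          (openConn (1 : Fin 8) (4 : Fin 8))ᶜ ∩ (openConn (2 : Fin 8) (4 : Fin 8))ᶜ)) := by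
  have h := fun (i j : Fin 8) => testBit_reachTable_iff_mem_openConn ω i j
  exact band_mem (band_mem (bnot_mem (h 0 1)) (bnot_mem (h 0 2)))
    (band_mem (band_mem (band_mem (band_mem (bnot_mem (h 1 2)) (bnot_mem (h 1 3))) (bnot_mem (h 2 3)))
      (bnot_mem (h 1 4))) (bnot_mem (h 2 4)))

/-- **Evaluation of `μ(E ∩ X)` on `Fin 8`** for events `E`, `X` whose indicators are the `Bool` tests `e`, `f` on the reach
table: the exact weighted count of `e && f`. [this file] -/
theorem real_inter_of_tests {l : List (Fin 8 × Fin 8 × ℚ)} (hnd : (wPairs l).Nodup)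
    (hq : ∀ x ∈ l, 0 ≤ x.2.2 ∧ x.2.2 ≤ 1) (e f : List ℕ → Bool) (E X : Set (BondConfig (Fin 8)))
    (heE : ∀ ω : List (Fin 8 × Fin 8), e (reachTable 8 ω) = true ↔ (↑(Eset ω) : Set (Sym2 (Fin 8))) ∈ E)
    (hfX : ∀ ω : List (Fin 8 × Fin 8), f (reachTable 8 ω) = true ↔ (↑(Eset ω) : Set (Sym2 (Fin 8))) ∈ X) :
    (prodBernoulli (wOfList l)).real (E ∩ X) =
      ((((wtabs 8 l).map fun t => if (e t.1 && f t.1) then t.2 else 0).sum : ℚ) : ℝ) :=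
  real_eq_wcount hnd hq (fun tb => e tb && f tb) _ fun ω => band_mem (heE ω) (hfX ω)

/-- **From one checkable rational fact to the violating instance** (covariance form of AS[oo]): for an event `E` with
`Bool` test `e`, if the weighted counts satisfy `#(E)·#(E ∩ {0↔3} ∩ {0↔4}) < #(E ∩ {0↔3})·#(E ∩ {0↔4})` then so do the
probabilities. [this file] -/
theorem violation_of_check (l : List (Fin 8 × Fin 8 × ℚ)) (hnd : (wPairs l).Nodup)
    (hq : ∀ x ∈ l, 0 ≤ x.2.2 ∧ x.2.2 ≤ 1) (e : List ℕ → Bool) (E : Set (BondConfig (Fin 8)))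
    (heE : ∀ ω : List (Fin 8 × Fin 8), e (reachTable 8 ω) = true ↔ (↑(Eset ω) : Set (Sym2 (Fin 8))) ∈ E)
    (hlt : ((wtabs 8 l).map fun t => if (e t.1 && true) then t.2 else 0).sum *
        ((wtabs 8 l).map fun t => if (e t.1 && ((t.1.getD 0 0).testBit 3 && (t.1.getD 0 0).testBit 4)) then t.2 else 0).sum <
      ((wtabs 8 l).map fun t => if (e t.1 && (t.1.getD 0 0).testBit 3) then t.2 else 0).sum *
        ((wtabs 8 l).map fun t => if (e t.1 && (t.1.getD 0 0).testBit 4) then t.2 else 0).sum) :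
    (prodBernoulli (wOfList l)).real E *
      (prodBernoulli (wOfList l)).real (E ∩ (openConn (0 : Fin 8) (3 : Fin 8) ∩ openConn (0 : Fin 8) (4 : Fin 8))) <
    (prodBernoulli (wOfList l)).real (E ∩ openConn (0 : Fin 8) (3 : Fin 8)) *
      (prodBernoulli (wOfList l)).real (E ∩ openConn (0 : Fin 8) (4 : Fin 8)) := by
  have hE : (prodBernoulli (wOfList l)).real E =
      ((((wtabs 8 l).map fun t => if (e t.1 && true) then t.2 else 0).sum : ℚ) : ℝ) := by
    have key := real_inter_of_tests hnd hq e (fun _ => true) E Set.univ heE (fun ω => by simp)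
    rwa [Set.inter_univ] at key
  have h3 := real_inter_of_tests hnd hq e (fun tb => (tb.getD 0 0).testBit 3) E _ heE
    (fun ω => testBit_reachTable_iff_mem_openConn ω (0 : Fin 8) (3 : Fin 8))
  have h4 := real_inter_of_tests hnd hq e (fun tb => (tb.getD 0 0).testBit 4) E _ heE
    (fun ω => testBit_reachTable_iff_mem_openConn ω (0 : Fin 8) (4 : Fin 8))
  have h34 := real_inter_of_tests hnd hq e (fun tb => (tb.getD 0 0).testBit 3 && (tb.getD 0 0).testBit 4) E _ heE
    (fun ω => band_mem (testBit_reachTable_iff_mem_openConn ω (0 : Fin 8) (3 : Fin 8))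
      (testBit_reachTable_iff_mem_openConn ω (0 : Fin 8) (4 : Fin 8)))
  rw [hE, h3, h4, h34]
  exact_mod_cast hlt

end ThreeClusterAssortCex

open ThreeClusterAssortCex in
/-- **AS[oo] fails: the instance.**  There is a weight function `w` on the pairs of `Fin 8` — `w(1,5) = w(5,6) = w(2,7) =
w(6,7) = w(0,5) = w(0,7) = w(3,5) = w(4,7) = 1/2`, `w(1,6) = w(2,6) = 999/1000`, all other pairs `0` — such that for
`μ = prodBernoulli w` and `E = {0↮1} ∩ {0↮2} ∩ ({1↮2} ∩ {1↮3} ∩ {2↮3} ∩ {1↮4} ∩ {2↮4})` the two INCREASING events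
`{0 ↔ 3}`, `{0 ↔ 4}` of the cluster of `0` are strictly NEGATIVELY correlated given `E`:
`μ(E ∩ {0↔3}) · μ(E ∩ {0↔4}) > μ(E ∩ ({0↔3} ∩ {0↔4})) · μ(E)`
(`84009·2004 = 168354036 < 169208064 = 13008²` in units of `(2.56·10⁸)⁻²`; exact rationals by `native_decide`), stated in the
binder shape of `threeClusterAssort_false` with `(s,t,u,a,b) = (0,1,2,3,4)`. [this file] -/
theorem threeClusterAssort_cex : ∃ w : Sym2 (Fin 8) → unitInterval,
    ¬ ((prodBernoulli w).real ((openConn (0 : Fin 8) (1 : Fin 8) : Set (BondConfig (Fin 8)))ᶜ ∩ (openConn (0 : Fin 8) (2 : Fin 8))ᶜ ∩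
            ((openConn (1 : Fin 8) (2 : Fin 8))ᶜ ∩ (openConn (1 : Fin 8) (3 : Fin 8))ᶜ ∩ (openConn (2 : Fin 8) (3 : Fin 8))ᶜ ∩
              (openConn (1 : Fin 8) (4 : Fin 8))ᶜ ∩ (openConn (2 : Fin 8) (4 : Fin 8))ᶜ) ∩
            openConn (0 : Fin 8) (3 : Fin 8)) *
        (prodBernoulli w).real ((openConn (0 : Fin 8) (1 : Fin 8) : Set (BondConfig (Fin 8)))ᶜ ∩ (openConn (0 : Fin 8) (2 : Fin 8))ᶜ ∩
            ((openConn (1 : Fin 8) (2 : Fin 8))ᶜ ∩ (openConn (1 : Fin 8) (3 : Fin 8))ᶜ ∩ (openConn (2 : Fin 8) (3 : Fin 8))ᶜ ∩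
              (openConn (1 : Fin 8) (4 : Fin 8))ᶜ ∩ (openConn (2 : Fin 8) (4 : Fin 8))ᶜ) ∩
            openConn (0 : Fin 8) (4 : Fin 8)) ≤
      (prodBernoulli w).real ((openConn (0 : Fin 8) (1 : Fin 8) : Set (BondConfig (Fin 8)))ᶜ ∩ (openConn (0 : Fin 8) (2 : Fin 8))ᶜ ∩
            ((openConn (1 : Fin 8) (2 : Fin 8))ᶜ ∩ (openConn (1 : Fin 8) (3 : Fin 8))ᶜ ∩ (openConn (2 : Fin 8) (3 : Fin 8))ᶜ ∩
              (openConn (1 : Fin 8) (4 : Fin 8))ᶜ ∩ (openConn (2 : Fin 8) (4 : Fin 8))ᶜ) ∩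
            (openConn (0 : Fin 8) (3 : Fin 8) ∩ openConn (0 : Fin 8) (4 : Fin 8))) *
        (prodBernoulli w).real ((openConn (0 : Fin 8) (1 : Fin 8) : Set (BondConfig (Fin 8)))ᶜ ∩ (openConn (0 : Fin 8) (2 : Fin 8))ᶜ ∩
            ((openConn (1 : Fin 8) (2 : Fin 8))ᶜ ∩ (openConn (1 : Fin 8) (3 : Fin 8))ᶜ ∩ (openConn (2 : Fin 8) (3 : Fin 8))ᶜ ∩
              (openConn (1 : Fin 8) (4 : Fin 8))ᶜ ∩ (openConn (2 : Fin 8) (4 : Fin 8))ᶜ))) := by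
  have hgt := violation_of_check
    [(1, 5, 1/2), (5, 6, 1/2), (2, 7, 1/2), (6, 7, 1/2), (0, 5, 1/2), (0, 7, 1/2), (3, 5, 1/2), (4, 7, 1/2),
      (1, 6, 999/1000), (2, 6, 999/1000)] (by decide)
    (by
      intro x hx
      simp only [List.mem_cons, List.not_mem_nil, or_false] at hx
      rcases hx with rfl | rfl | rfl | rfl | rfl | rfl | rfl | rfl | rfl | rfl <;> norm_num)
    (fun tb : List ℕ =>
        ((!(tb.getD 0 0).testBit 1 && !(tb.getD 0 0).testBit 2) &&
          ((((!(tb.getD 1 0).testBit 2 && !(tb.getD 1 0).testBit 3) && !(tb.getD 2 0).testBit 3) &&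
            !(tb.getD 1 0).testBit 4) && !(tb.getD 2 0).testBit 4)))
    ((openConn (0 : Fin 8) (1 : Fin 8) : Set (BondConfig (Fin 8)))ᶜ ∩ (openConn (0 : Fin 8) (2 : Fin 8))ᶜ ∩
        ((openConn (1 : Fin 8) (2 : Fin 8))ᶜ ∩ (openConn (1 : Fin 8) (3 : Fin 8))ᶜ ∩ (openConn (2 : Fin 8) (3 : Fin 8))ᶜ ∩
          (openConn (1 : Fin 8) (4 : Fin 8))ᶜ ∩ (openConn (2 : Fin 8) (4 : Fin 8))ᶜ))
    eTest_iff (by native_decide)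
  exact ⟨_, fun hle => (not_le.2 hgt) (hle.trans_eq (mul_comm _ _))⟩

/-- **No-go: the last cell of the three-cluster inventory ("AS[oo]") is false.**  It is false that for every finite
weighted graph and all pairwise distinct `s, t, u, a, b`, with
`E = {s ↮ t} ∩ {s ↮ u} ∩ ({t ↮ u} ∩ {t ↮ a} ∩ {u ↮ a} ∩ {t ↮ b} ∩ {u ↮ b})` ("`s, t, u` in three clusters and `a, b`
outside `C_t ∪ C_u`"), `μ(E ∩ {s↔a}) · μ(E ∩ {s↔b}) ≤ μ(E ∩ ({s↔a} ∩ {s↔b})) · μ(E)` — i.e. the sharpening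
`μ({s↮t} ∩ {s↮u}) ↦ μ(E)` of the tree theorem `Literature.Probability.Percolation.threeSep_assort_oo_exchange` fails.
Witness `threeClusterAssort_cex` (`n = 8`, `(s,t,u,a,b) = (0,1,2,3,4)`). [this file] -/
theorem threeClusterAssort_false :
    ¬ (∀ (n : ℕ) (w : Sym2 (Fin n) → unitInterval) (s t u a b : Fin n), [s, t, u, a, b].Nodup →
      (prodBernoulli w).real ((openConn s t : Set (BondConfig (Fin n)))ᶜ ∩ (openConn s u)ᶜ ∩
            ((openConn t u)ᶜ ∩ (openConn t a)ᶜ ∩ (openConn u a)ᶜ ∩ (openConn t b)ᶜ ∩ (openConn u b)ᶜ) ∩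
            openConn s a) *
        (prodBernoulli w).real ((openConn s t : Set (BondConfig (Fin n)))ᶜ ∩ (openConn s u)ᶜ ∩
            ((openConn t u)ᶜ ∩ (openConn t a)ᶜ ∩ (openConn u a)ᶜ ∩ (openConn t b)ᶜ ∩ (openConn u b)ᶜ) ∩
            openConn s b) ≤
      (prodBernoulli w).real ((openConn s t : Set (BondConfig (Fin n)))ᶜ ∩ (openConn s u)ᶜ ∩
            ((openConn t u)ᶜ ∩ (openConn t a)ᶜ ∩ (openConn u a)ᶜ ∩ (openConn t b)ᶜ ∩ (openConn u b)ᶜ) ∩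
            (openConn s a ∩ openConn s b)) *
        (prodBernoulli w).real ((openConn s t : Set (BondConfig (Fin n)))ᶜ ∩ (openConn s u)ᶜ ∩
            ((openConn t u)ᶜ ∩ (openConn t a)ᶜ ∩ (openConn u a)ᶜ ∩ (openConn t b)ᶜ ∩ (openConn u b)ᶜ))) := by
  intro h
  obtain ⟨w, hw⟩ := threeClusterAssort_cex
  exact hw (h 8 w 0 1 2 3 4 (by decide))

end Summit.CriticalPhenomena.PercolationContinuityZ3.Theorems
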